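import Mathlib.RingTheory.SimpleModule.Isotypic
import Literature.RepresentationTheory.Semisimple.CliffordRestriction
import Literature.RepresentationTheory.Semisimple.SubrepresentationEquiv
import HarnessLib

/-!
# Clifford–Tate structure, the Clifford core: an irreducible representation restricted to a normal
# subgroup is isotypic or carries a proper system of imprimitivity

Pure algebra behind the Clifford–Tate structure theorem
(`Summit.Langlands.Langlands.Theses.MonodromyDichotomy.CliffordTateStructure`).  Let `k` be a field,
`π : G → GL(V)` an IRREDUCIBLE finite-dimensional representation and `N ◁ G` a normal subgroup.
By Clifford's theorem (tree: `Representation.isSemisimpleRepresentation_restrictSubgroup`) `π|_N`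
is semisimple, so `V|_N` is the direct sum of its isotypic components (Mathlib
`isotypicComponents`, `sSupIndep_isotypicComponents`, `sSup_isotypicComponents`).  We prove that
`π(g)` PERMUTES the isotypic components of `V|_N` (`nTranslate_mem_isotypicComponents`: an
isotypic component is a minimal non-zero fully invariant submodule, and conjugation by `π(g)`
preserves the commutant of `π(N)`), and deduce **Clifford's dichotomy**
(`isIsotypic_or_exists_imprimitivity`): either `V|_N` is ISOTYPIC, or the stabiliser `H ⊇ N` of
one isotypic component `U` is a PROPER subgroup and `(U, H)` is a system of imprimitivity —
`π(g) U = U ↔ g ∈ H`, the translates `π(g) U` are independent and span `V` (so that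
`π ≅ Ind_H^G U`, file `CliffordTateStructureInducedFrame`).
[cite: Clifford1937, Thm. 1–2] [cite: CurtisReiner1962, (49.2), (49.7)]
[cite: SerreLinearRepresentations1977, §2.6 Thm. 8, §7.1]
-/

set_option autoImplicit false
set_option linter.dupNamespace false

noncomputable section

namespace Summit.Langlands.Langlands.Theorems

/-! ### Isotypic components are the minimal non-zero fully invariant submodules -/

section Minimal

variable {R : Type*} [Ring R] {M : Type*} [AddCommGroup M] [Module R M]

/-- In a semisimple module, a submodule is an isotypic component iff it is a MINIMAL non-zero fully
invariant submodule (the fully invariant submodules are the sums of isotypic components, which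
are independent). [cite: CurtisReiner1962, (49.2)] -/
theorem mem_isotypicComponents_iff_minimal [IsSemisimpleModule R M] (c : Submodule R M) :
    c ∈ isotypicComponents R M ↔ c.IsFullyInvariant ∧ c ≠ ⊥ ∧
      ∀ m : Submodule R M, m.IsFullyInvariant → m ≠ ⊥ → m ≤ c → m = c := by
  constructor
  · intro hc
    refine ⟨Submodule.IsFullyInvariant.of_mem_isotypicComponents hc,
      (bot_lt_isotypicComponents hc).ne', fun m hm hmb hmc => ?_⟩
    obtain ⟨s, hs, rfl⟩ := isFullyInvariant_iff_sSup_isotypicComponents.1 hm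
    have hsne : s.Nonempty := Set.nonempty_iff_ne_empty.2 fun h => hmb (by rw [h, sSup_empty])
    obtain ⟨c', hc'⟩ := hsne
    have hc'c : c' ≤ sSup s := le_sSup hc'
    have h1 : c' = c := by
      by_contra hne
      have hdis : Disjoint c' c :=
        (sSupIndep_isotypicComponents R M).pairwiseDisjoint (hs hc') hc hne
      exact (bot_lt_isotypicComponents (hs hc')).ne' (hdis.eq_bot_of_le (hc'c.trans hmc))
    exact le_antisymm hmc (h1 ▸ hc'c)
  · rintro ⟨hci, hcb, hmin⟩
    obtain ⟨s, hs, hcs⟩ := isFullyInvariant_iff_sSup_isotypicComponents.1 hci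
    have hsne : s.Nonempty := Set.nonempty_iff_ne_empty.2 fun h => hcb (by rw [hcs, h, sSup_empty])
    obtain ⟨c', hc'⟩ := hsne
    have h1 : c' = c := hmin c' (Submodule.IsFullyInvariant.of_mem_isotypicComponents (hs hc'))
      (bot_lt_isotypicComponents (hs hc')).ne' (hcs ▸ le_sSup hc')
    exact h1 ▸ hs hc'

end Minimal

/-! ### The `k`-subspace underlying a `k[N]`-submodule of `V|_N`, and its translates by `π(g)` -/

section CliffordCore

open scoped MonoidAlgebra

variable {k : Type*} [Field k] {G : Type*} [Group G] {V : Type*} [AddCommGroup V] [Module k V]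
  (π : Representation k G V) (N : Subgroup G)

/-- The restriction `π|_N` as a representation of `N` (reducible abbreviation, so that the
`Representation` dot-notation `asModule`, `asModuleEquiv`, … applies). -/
abbrev resN : Representation k N V := π.comp N.subtype

/-- The `k`-subspace of `V` underlying a `k[N]`-submodule of `(π|_N).asModule`. [folklore] -/
def nSubspace (X : Submodule (MonoidAlgebra k N) (resN π N).asModule) : Submodule k V :=
  (X.restrictScalars k).map (resN π N).asModuleEquiv.toLinearMap

variable {π N}
/-- Membership in `nSubspace X`: `v ∈ nSubspace X ↔ v ∈ X` (as an element of `(π|_N).asModule`). [folklore] -/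
theorem mem_nSubspace_iff {X : Submodule (MonoidAlgebra k N) (resN π N).asModule} {v : V} :
    v ∈ nSubspace π N X ↔ (resN π N).asModuleEquiv.symm v ∈ X := by
  unfold nSubspace
  rw [Submodule.mem_map_equiv, Submodule.restrictScalars_mem]
/-- `nSubspace` preserves and reflects `≤`. [folklore] -/
theorem nSubspace_le_iff {X Y : Submodule (MonoidAlgebra k N) (resN π N).asModule} :
    nSubspace π N X ≤ nSubspace π N Y ↔ X ≤ Y := by
  constructor
  · intro h x hx
    have h1 : (resN π N).asModuleEquiv x ∈ nSubspace π N X := by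
      rw [mem_nSubspace_iff, LinearEquiv.symm_apply_apply]; exact hx
    have h2 := h h1
    rw [mem_nSubspace_iff, LinearEquiv.symm_apply_apply] at h2
    exact h2
  · intro h v hv
    rw [mem_nSubspace_iff] at hv ⊢
    exact h hv
/-- `nSubspace` is injective. [folklore] -/
theorem nSubspace_injective : Function.Injective (nSubspace π N) := fun _ _ h =>
  le_antisymm (nSubspace_le_iff.1 h.le) (nSubspace_le_iff.1 h.ge)
/-- `nSubspace ⊥ = ⊥`. [folklore] -/
theorem nSubspace_bot : nSubspace π N ⊥ = ⊥ := by
  unfold nSubspace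
  rw [Submodule.restrictScalars_bot, Submodule.map_bot]
/-- `nSubspace X = ⊥ ↔ X = ⊥`. [folklore] -/
theorem nSubspace_eq_bot_iff {X : Submodule (MonoidAlgebra k N) (resN π N).asModule} :
    nSubspace π N X = ⊥ ↔ X = ⊥ := by
  rw [← nSubspace_bot (π := π) (N := N), nSubspace_injective.eq_iff]
/-- `nSubspace ⊤ = ⊤`. [folklore] -/
theorem nSubspace_top : nSubspace π N ⊤ = ⊤ := by
  unfold nSubspace
  rw [Submodule.restrictScalars_top, Submodule.map_top, LinearEquiv.range]
/-- `nSubspace X = ⊤ ↔ X = ⊤`. [folklore] -/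
theorem nSubspace_eq_top_iff {X : Submodule (MonoidAlgebra k N) (resN π N).asModule} :
    nSubspace π N X = ⊤ ↔ X = ⊤ := by
  rw [← nSubspace_top (π := π) (N := N), nSubspace_injective.eq_iff]
/-- `nSubspace` commutes with `sSup`. [folklore] -/
theorem nSubspace_sSup (s : Set (Submodule (MonoidAlgebra k N) (resN π N).asModule)) :
    nSubspace π N (sSup s) = sSup (nSubspace π N '' s) := by
  unfold nSubspace
  rw [Submodule.restrictScalars_sSup, sSup_image, sSup_image, Submodule.map_iSup]
  congr 1
  funext X
  rw [Submodule.map_iSup]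
/-- `nSubspace` commutes with `⊓`. [folklore] -/
theorem nSubspace_inf (X Y : Submodule (MonoidAlgebra k N) (resN π N).asModule) :
    nSubspace π N (X ⊓ Y) = nSubspace π N X ⊓ nSubspace π N Y := by
  unfold nSubspace
  rw [Submodule.restrictScalars_inf,
    Submodule.map_inf _ (resN π N).asModuleEquiv.injective]
/-- `nSubspace` preserves and reflects disjointness. [folklore] -/
theorem disjoint_nSubspace_iff {X Y : Submodule (MonoidAlgebra k N) (resN π N).asModule} :
    Disjoint (nSubspace π N X) (nSubspace π N Y) ↔ Disjoint X Y := by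
  rw [disjoint_iff, disjoint_iff, ← nSubspace_inf, nSubspace_eq_bot_iff]

/-- Independence of a set of `k[N]`-submodules passes to the underlying `k`-subspaces. [folklore] -/
theorem sSupIndep_image_nSubspace {s : Set (Submodule (MonoidAlgebra k N) (resN π N).asModule)}
    (h : sSupIndep s) : sSupIndep (nSubspace π N '' s) := by
  rintro _ ⟨X, hX, rfl⟩
  rw [← Set.image_singleton, ← Set.image_sdiff nSubspace_injective, ← nSubspace_sSup,
    disjoint_nSubspace_iff]
  exact h hX

/-- `N` preserves the underlying subspace of a `k[N]`-submodule. [folklore] -/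
theorem apply_mem_nSubspace {X : Submodule (MonoidAlgebra k N) (resN π N).asModule}
    {n : G} (hn : n ∈ N) {v : V} (hv : v ∈ nSubspace π N X) : π n v ∈ nSubspace π N X := by
  rw [mem_nSubspace_iff] at hv ⊢
  have h1 : π n v = (resN π N) ⟨n, hn⟩ v := rfl
  rw [h1, Representation.asModuleEquiv_symm_map_rho]
  exact X.smul_mem _ hv

/-- For `n ∈ N`, `π(n)` maps the underlying subspace ONTO itself. [folklore] -/
theorem map_nSubspace_eq_of_mem {X : Submodule (MonoidAlgebra k N) (resN π N).asModule}
    {n : G} (hn : n ∈ N) : (nSubspace π N X).map (π n) = nSubspace π N X := by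
  refine le_antisymm ?_ fun v hv => ?_
  · rintro _ ⟨v, hv, rfl⟩
    exact apply_mem_nSubspace hn hv
  · refine ⟨π n⁻¹ v, apply_mem_nSubspace (inv_mem hn) hv, ?_⟩
    rw [← Module.End.mul_apply, ← map_mul, mul_inv_cancel, map_one, Module.End.one_apply]

variable (π N)

/-- **The translate `π(g) X` of a `k[N]`-submodule `X` of `V|_N`, for `N` normal**: the subspace
`π(g) X`, which is again `N`-stable (`π(n) π(g) x = π(g) π(g⁻¹ n g) x`), as a `k[N]`-submodule.
[cite: Clifford1937, §1] -/
def nTranslate [N.Normal] (g : G) (X : Submodule (MonoidAlgebra k N) (resN π N).asModule) :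
    Submodule (MonoidAlgebra k N) (resN π N).asModule :=
  Subrepresentation.asSubmodule (ρ := resN π N)
    ⟨(nSubspace π N X).map (π g), fun n v hv => by
      obtain ⟨x, hx, rfl⟩ := hv
      refine ⟨π (g⁻¹ * n * g) x, apply_mem_nSubspace (Subgroup.Normal.conj_mem' inferInstance _ n.2 g) hx,
        ?_⟩
      change π g (π (g⁻¹ * n * g) x) = π n (π g x)
      rw [← Module.End.mul_apply, ← map_mul, ← Module.End.mul_apply, ← map_mul]
      congr 2
      group⟩

variable {π N}
variable [N.Normal]
/-- The subspace underlying the translate `g · X` is `π(g) (nSubspace X)`. [folklore] -/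
theorem nSubspace_nTranslate (g : G) (X : Submodule (MonoidAlgebra k N) (resN π N).asModule) :
    nSubspace π N (nTranslate π N g X) = (nSubspace π N X).map (π g) := by
  ext v
  rw [mem_nSubspace_iff]
  exact Iff.rfl
/-- Translating by `g` and then by `g⁻¹` gives back `X`. [folklore] -/
theorem nTranslate_mul_cancel_left (g : G)
    (X : Submodule (MonoidAlgebra k N) (resN π N).asModule) :
    nTranslate π N g⁻¹ (nTranslate π N g X) = X := by
  apply nSubspace_injective
  rw [nSubspace_nTranslate, nSubspace_nTranslate, ← Submodule.map_comp, ← Module.End.mul_eq_comp,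
    ← map_mul, inv_mul_cancel, map_one, Module.End.one_eq_id, Submodule.map_id]

/-- Translation by `g` is monotone. [folklore] -/
theorem nTranslate_mono (g : G) {X Y : Submodule (MonoidAlgebra k N) (resN π N).asModule}
    (h : X ≤ Y) : nTranslate π N g X ≤ nTranslate π N g Y := by
  rw [← nSubspace_le_iff, nSubspace_nTranslate, nSubspace_nTranslate]
  exact Submodule.map_mono (nSubspace_le_iff.2 h)

/-- The translate of a non-zero submodule is non-zero. [folklore] -/
theorem nTranslate_ne_bot (g : G) {X : Submodule (MonoidAlgebra k N) (resN π N).asModule}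
    (h : X ≠ ⊥) : nTranslate π N g X ≠ ⊥ := by
  intro h1
  apply h
  have h2 := congrArg (nTranslate π N g⁻¹) h1
  rw [nTranslate_mul_cancel_left] at h2
  rw [h2]
  apply nSubspace_injective
  rw [nSubspace_nTranslate, nSubspace_bot, Submodule.map_bot]

/-- **Conjugation by `π(g)` preserves the commutant of `π(N)`**, hence `π(g)` maps fully
invariant `k[N]`-submodules to fully invariant ones. [cite: Clifford1937, §1] -/
theorem isFullyInvariant_nTranslate (g : G)
    {X : Submodule (MonoidAlgebra k N) (resN π N).asModule} (hX : X.IsFullyInvariant) :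
    (nTranslate π N g X).IsFullyInvariant := by
  intro f v hv
  -- `f` read on `V`, and its conjugate `ψ = π(g)⁻¹ f π(g)`, again `N`-equivariant
  set fI : (resN π N).IntertwiningMap (resN π N) :=
    (Representation.IntertwiningMap.equivLinearMapAsModule _ _).symm f with hfI
  have hfv : ∀ w : V, f w = fI.toLinearMap w := fun w => rfl
  have hfN : ∀ (n : G) (hn : n ∈ N) (w : V), fI.toLinearMap (π n w) = π n (fI.toLinearMap w) := by
    intro n hn w
    have h1 := LinearMap.congr_fun (fI.isIntertwining' ⟨n, hn⟩) w
    exact h1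
  set ψ : V →ₗ[k] V := π g⁻¹ ∘ₗ fI.toLinearMap ∘ₗ π g with hψ
  have hψN : ∀ (n : N) (w : V), ψ ((resN π N) n w) = (resN π N) n (ψ w) := by
    intro n w
    change π g⁻¹ (fI.toLinearMap (π g (π n w))) = π n (π g⁻¹ (fI.toLinearMap (π g w)))
    have h1 : π g (π (n : G) w) = π (g * n * g⁻¹) (π g w) := by
      rw [← Module.End.mul_apply, ← map_mul, ← Module.End.mul_apply, ← map_mul]
      congr 2
      group
    rw [h1, hfN _ (Subgroup.Normal.conj_mem inferInstance _ n.2 g), ← Module.End.mul_apply,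
      ← map_mul, ← Module.End.mul_apply (f := π (n : G)), ← map_mul]
    congr 2
    group
  set f' : Module.End (MonoidAlgebra k N) (resN π N).asModule :=
    Representation.IntertwiningMap.equivLinearMapAsModule _ _
      (ψ.intertwiningMap_of_isIntertwiningMap (resN π N) (resN π N) hψN) with hf'
  have hf'v : ∀ w : V, f' w = ψ w := fun w => rfl
  -- `v = π(g) x` with `x ∈ X`; then `f v = π(g) (ψ x)` and `ψ x = f' x ∈ X`
  have hv' : (v : V) ∈ (nSubspace π N X).map (π g) := by
    rw [← nSubspace_nTranslate]
    exact (mem_nSubspace_iff (v := (v : V))).2 hv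
  obtain ⟨x, hx, hxv⟩ := hv'
  have hxX : (resN π N).asModuleEquiv.symm x ∈ X := mem_nSubspace_iff.1 hx
  have hf'x : f' ((resN π N).asModuleEquiv.symm x) ∈ X := hX f' hxX
  change f v ∈ nTranslate π N g X
  have h1 : (f v : V) = π g (ψ x) := by
    rw [hfv, ← hxv]
    change fI.toLinearMap (π g x) = π g (π g⁻¹ (fI.toLinearMap (π g x)))
    rw [← Module.End.mul_apply (f := π g), ← map_mul, mul_inv_cancel, map_one, Module.End.one_apply]
  have h2 : (f v : V) ∈ nSubspace π N (nTranslate π N g X) := by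
    rw [nSubspace_nTranslate, h1]
    exact ⟨ψ x, mem_nSubspace_iff.2 hf'x, rfl⟩
  exact mem_nSubspace_iff.1 h2

/-- **`π(g)` permutes the isotypic components of `V|_N`** (`N` normal). [cite: Clifford1937, Thm. 1]
[cite: CurtisReiner1962, (49.7)] -/
theorem nTranslate_mem_isotypicComponents
    [IsSemisimpleModule (MonoidAlgebra k N) (resN π N).asModule] (g : G)
    {c : Submodule (MonoidAlgebra k N) (resN π N).asModule}
    (hc : c ∈ isotypicComponents (MonoidAlgebra k N) (resN π N).asModule) :
    nTranslate π N g c ∈ isotypicComponents (MonoidAlgebra k N) (resN π N).asModule := by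
  rw [mem_isotypicComponents_iff_minimal] at hc ⊢
  obtain ⟨hci, hcb, hmin⟩ := hc
  refine ⟨isFullyInvariant_nTranslate g hci, nTranslate_ne_bot g hcb, fun m hm hmb hmc => ?_⟩
  have h1 : nTranslate π N g⁻¹ m ≤ c := by
    have := nTranslate_mono g⁻¹ hmc
    rwa [nTranslate_mul_cancel_left] at this
  have h2 : nTranslate π N g⁻¹ m = c :=
    hmin _ (isFullyInvariant_nTranslate g⁻¹ hm) (nTranslate_ne_bot g⁻¹ hmb) h1
  have h3 := congrArg (nTranslate π N g⁻¹⁻¹) h2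
  rw [nTranslate_mul_cancel_left, inv_inv] at h3
  exact h3

/-! ### Clifford's dichotomy -/

omit [N.Normal] in
/-- `π|_N` is semisimple for `π` irreducible and `N` normal (Clifford), in module form. -/
theorem isSemisimpleModule_asModule_restrict [FiniteDimensional k V] [π.IsIrreducible] [N.Normal] :
    IsSemisimpleModule (MonoidAlgebra k N) (resN π N).asModule := by
  rw [← Representation.isSemisimpleRepresentation_iff_isSemisimpleModule_asModule]
  exact Literature.RepresentationTheory.Semisimple.Representation.isSemisimpleRepresentation_restrictSubgroup
    π N inferInstance

omit [N.Normal] in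
/-- A non-zero `G`-stable subspace of an irreducible representation is everything. -/
theorem eq_top_of_stable_of_ne_bot [π.IsIrreducible] {W : Submodule k V}
    (hW : ∀ g : G, ∀ v ∈ W, π g v ∈ W) (hWb : W ≠ ⊥) : W = ⊤ := by
  let W' : Subrepresentation π := ⟨W, fun g v hv => hW g v hv⟩
  rcases IsSimpleOrder.eq_bot_or_eq_top W' with h | h
  · exact absurd (congrArg Subrepresentation.toSubmodule h) hWb
  · exact congrArg Subrepresentation.toSubmodule h

/-- **Clifford's dichotomy.**  Let `π : G → GL(V)` be irreducible and finite-dimensional and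
`N ◁ G`.  Either `V|_N` is ISOTYPIC, or there are a PROPER subgroup `H ⊇ N` and a non-zero
`N`-stable subspace `U` (an isotypic component of `V|_N` and its stabiliser) forming a system of
imprimitivity: `π(g) U = U ↔ g ∈ H`, the translates `π(g) U` are independent and span `V`.
[cite: Clifford1937, Thm. 1–2] [cite: CurtisReiner1962, (49.7)]
[cite: SerreLinearRepresentations1977, §7.1] -/
theorem isIsotypic_or_exists_imprimitivity [FiniteDimensional k V] [π.IsIrreducible] :
    IsIsotypic (MonoidAlgebra k N) (resN π N).asModule ∨
    ∃ (U : Submodule k V) (H : Subgroup G), N ≤ H ∧ H ≠ ⊤ ∧ U ≠ ⊥ ∧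
      (∀ n ∈ N, ∀ u ∈ U, π n u ∈ U) ∧ (∀ g : G, U.map (π g) = U ↔ g ∈ H) ∧
      sSupIndep (Set.range fun g : G => U.map (π g)) ∧ ⨆ g : G, U.map (π g) = ⊤ := by
  classical
  haveI := isSemisimpleModule_asModule_restrict (π := π) (N := N)
  haveI : Nontrivial V := (subsingleton_or_nontrivial V).resolve_left fun hV =>
    IsSimpleOrder.bot_ne_top (α := Subrepresentation π)
      (Subrepresentation.toSubmodule_injective (Subsingleton.elim _ _))
  haveI : Nontrivial (resN π N).asModule := ‹Nontrivial V›
  -- an isotypic component `c` of `V|_N`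
  obtain ⟨c, hc⟩ : (isotypicComponents (MonoidAlgebra k N) (resN π N).asModule).Nonempty := by
    refine Set.nonempty_iff_ne_empty.2 fun h => ?_
    have h1 := sSup_isotypicComponents (MonoidAlgebra k N) (resN π N).asModule
    rw [h, sSup_empty] at h1
    exact bot_ne_top h1
  set U : Submodule k V := nSubspace π N c with hUdef
  have hUg : ∀ g : G, U.map (π g) = nSubspace π N (nTranslate π N g c) := fun g =>
    (nSubspace_nTranslate g c).symm
  -- its stabiliser `H`
  let H : Subgroup G :=
    { carrier := {g | U.map (π g) = U}
      one_mem' := by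
        change U.map (π 1) = U
        rw [map_one, Module.End.one_eq_id, Submodule.map_id]
      mul_mem' := fun {a b} ha hb => by
        change U.map (π (a * b)) = U
        change U.map (π a) = U at ha
        change U.map (π b) = U at hb
        rw [map_mul, Module.End.mul_eq_comp, Submodule.map_comp, hb, ha]
      inv_mem' := fun {a} ha => by
        change U.map (π a⁻¹) = U
        change U.map (π a) = U at ha
        conv_lhs => rw [← ha]
        rw [← Submodule.map_comp, ← Module.End.mul_eq_comp, ← map_mul, inv_mul_cancel, map_one,
          Module.End.one_eq_id, Submodule.map_id] }
  have hHmem : ∀ g : G, g ∈ H ↔ U.map (π g) = U := fun g => Iff.rfl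
  have hNH : N ≤ H := fun n hn => (hHmem n).2 (map_nSubspace_eq_of_mem hn)
  have hUb : U ≠ ⊥ := fun h => (bot_lt_isotypicComponents hc).ne' (nSubspace_eq_bot_iff.1 h)
  have hsup : ⨆ g : G, U.map (π g) = ⊤ := by
    apply eq_top_of_stable_of_ne_bot (π := π)
    · intro h v hv
      have h1 : π h v ∈ (⨆ g : G, U.map (π g)).map (π h) := Submodule.mem_map_of_mem hv
      rw [Submodule.map_iSup] at h1
      have h2 : (⨆ g : G, (U.map (π g)).map (π h)) ≤ ⨆ g : G, U.map (π g) := by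
        refine iSup_le fun g => ?_
        rw [← Submodule.map_comp, ← Module.End.mul_eq_comp, ← map_mul]
        exact le_iSup (fun g : G => U.map (π g)) (h * g)
      exact h2 h1
    · intro h
      apply hUb
      rw [eq_bot_iff, ← h]
      refine le_trans (le_of_eq ?_) (le_iSup (fun g : G => U.map (π g)) 1)
      rw [map_one, Module.End.one_eq_id, Submodule.map_id]
  by_cases hH : H = ⊤
  · -- every `g` stabilises `U`: `U = V`, `c = ⊤`, `V|_N` is isotypic
    left
    have hU : U = ⊤ := by
      rw [← hsup]
      refine le_antisymm ?_ (iSup_le fun g => le_of_eq ((hHmem g).1 (hH ▸ Subgroup.mem_top g)))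
      refine le_trans (le_of_eq ?_) (le_iSup (fun g : G => U.map (π g)) 1)
      rw [map_one, Module.End.one_eq_id, Submodule.map_id]
    have hct : c = ⊤ := nSubspace_eq_top_iff.1 hU
    have h1 : IsIsotypic (MonoidAlgebra k N) c := IsIsotypic.isotypicComponents hc
    rw [hct] at h1
    exact Submodule.topEquiv.isIsotypic_iff.1 h1
  · right
    refine ⟨U, H, hNH, hH, hUb, fun n hn u hu => apply_mem_nSubspace hn hu, fun g => (hHmem g).symm,
      ?_, hsup⟩
    have h1 : Set.range (fun g : G => U.map (π g)) ⊆
        nSubspace π N '' isotypicComponents (MonoidAlgebra k N) (resN π N).asModule := by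
      rintro _ ⟨g, rfl⟩
      exact ⟨nTranslate π N g c, nTranslate_mem_isotypicComponents g hc, (hUg g).symm⟩
    exact (sSupIndep_image_nSubspace (sSupIndep_isotypicComponents _ _)).mono h1

end CliffordCore

end Summit.Langlands.Langlands.Theorems

end
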